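/-
Copyright (c) 2026 the pub-hodgecm-mathlib formalisation cell (harness21).  Prover seat hodgecm-mathlib-F0P3b-p01 (g26); E1 keeper ∕ dealer F0P3a-p03 (g30)
«= VERDICT + CUT (A)+(B)» 2026-09-03T04:01:05Z on CENSUS-R64 v1 b3df5796 (E1 BRICK LEDGER row 64-A).
-/
import Literature.NumberTheory.Automorphic.JacquetLengthTwoLabelsEmb                 -- ★ LABELS (Emb form): `nontrivial_coinvariants_of_injective_normalizedInd`; brings ★ `JacquetLengthTwoLabels` (`jacquetMap_equiv_injective`, `exact_subtype_mkQ`), ★ `JacquetLineCases`, ★ `JacquetLineExponents`, ★ `ConstituentsOfExtension`, ★ exactness ∕ Frobenius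
import Literature.NumberTheory.Automorphic.IrreducibleClassesConstituentsIsotypic    -- ★ `not_isConstituentOf_of_subsingleton`
import HarnessLib

/-!
# The labelled pair of a length-two representation whose two-dimensional Jacquet module is a self-extension of ONE character
# (the «same-exponent» twin of ★ `JacquetLengthTwoLabels{,Emb}`: [Casselman1995, §7.1] at a point where the two exponents coincide)

Generic representation theory (theorems only; no definition, no named fact, no instance, no notation).  Cell `pub/hodgecm-mathlib`, crux H413 =
`stmt-HodgeConjecture-24833` (`--supports` lane, count-neutral helper); E1 BRICK LEDGER row 64-A «(d1′) FOR K4′ — THE L.D.S. TWIN OF ROW 63» (census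
`F0/P3/F0P3b-p01/g26/r64/CENSUS-R64-d1prime.v1.md`).

THE SITUATION.  `t = (P, M, N_P)` a parabolic triple of a topological group `G` (`N_P` the union of its compact open subgroups, `δ_P|_{N_P} = 1`), `ρ` a smooth
representation with a `G`-stable `⊥ ≠ N ≠ ⊤` in a lattice without 3-chains, and `r(ρ)` (the normalised Jacquet module ★ `Representation.normalizedJacquet`)
TWO-dimensional with a stable line `ℓ` on which `M` acts by a character `θ` AND modulo which `M` acts by THE SAME `θ` — i.e. `r(ρ)` is a self-extension of
the character `θ` (`(r(m) − θ(m))² = 0`).  This is the shape of `r_B(i_B(θ̃))` for the unitary principal series of `U(3)` at a semi-regular `θ` ([Rogawski1990,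
§12.2 (3) pp. 173–174]: `w θ̃ = θ̃`, `JH(i_B(θ̃)) = Π(θ)` an l.d.s. `L`-packet; [Keys1984, §7]), where the labelled-pair package ★
`IrrClass.labelledPair_exists_of_line_normalizedInd` (hypothesis `θ₁ ≠ θ₂`) is vacuous.  The two-cases lemma ★ `Representation.normalizedJacquet_sub_quot_cases_of_line`
([Casselman1995, L. 7.1.1 (a), Cor. 7.1.2]) needs NO distinctness: along `0 → r(N) → r(ρ) → r(ρ∕N) → 0` (exact, ★ `Representation.jacquet_exact_holds`), if both
ends are non-zero then both are LINES and `M` acts on each by `θ` (either disjunct of the dichotomy says so when `θ₁ = θ₂ = θ`).  What distinctness of exponents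
used to supply — `⟦ρ|_N⟧ ≠ ⟦ρ∕N⟧` — is here an INPUT («two distinct constituents», `htwo`): at the `U(3)` datum it is Keys' reducibility + inequivalence
(R1)+(R2), RUNG 0's named input `hLdsTwo` ⟺ «LDS-REDUCIBLE-TWO» (★ `F0P3cStCharTSLdsTwoOfTwo`), carried, never asserted.
* §1 `IrrClass.labelledPair_of_line_same` — for a given `N` with `ρ|_N`, `ρ∕N` irreducible and BOTH Jacquet modules non-zero: the constituents of `ρ` are exactly
  `⟦ρ∕N⟧, ⟦ρ|_N⟧`, and `r(ρ|_N) ≅ 𝟙 ⊗ θ ≅ r(ρ∕N)` as `M`-modules.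
* §2 `IrrClass.labelledPair_exists_of_line_abs_same` — ONE-CALL form for an ABSTRACT `ρ ≅ i_P^G σ` in the currency of ★ `labelledPair_exists_of_line_abs` (unifiable
  binders, `eρ := Equiv.refl _` at a caller whose `ρ` is a `def`) — same binder list and conclusion, `(N) (hNb) (hNt) (hne : θ₁ ≠ θ₂)` replaced by `(heq : θ₁ = θ₂)` + `htwo` (the two
  letters `θ₁`, `θ₂` are kept, with an equation, so that a cited filtration is passed verbatim); non-vanishing of both Jacquet
  modules from the EMBEDDING property of the constituents ([Casselman1995, Cor. 6.3.9 (b)], hypothesis `hemb`) by Frobenius reciprocity (★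
  `nontrivial_coinvariants_of_injective_normalizedInd`).  Output = the inputs `(hne) (hJH) (hs) (hn)` of E1 row 63's `exists_realisation_schurPair` at `θ₁ = θ₂ = θ`,
  token for token.
* §3 `IrrClass.labelledPair_exists_of_line_normalizedInd_same` — the same for `ρ = i_P^G σ` literally (★ `labelledPair_exists_of_line_normalizedInd`'s currency).
HONEST LABEL: count-neutral generic helper; nothing printed is asserted (the distinctness of the two constituents is a hypothesis); h413 OPEN; HC_CM is proved only
modulo the 7 printed citations (2 remaining named inputs hLiu418 = stmt-HodgeConjecture-24832, h413 = stmt-HodgeConjecture-24833) until rung 0 closes.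

## References
* [Casselman1995] W. Casselman, *Introduction to the theory of admissible representations of p-adic reductive groups* (draft 1 May 1995), §3.2 (Prop. 3.2.3,
  Thm. 3.2.4), §6.3 Cor. 6.3.9 (b), §6.4 Prop. 6.4.1, §7.1 L. 7.1.1 (a), Cor. 7.1.2.
* [BernsteinZelevinsky1977] I. N. Bernstein, A. V. Zelevinsky, *Induced representations of reductive p-adic groups I*, Ann. Sci. ÉNS 10 (1977), Prop. 1.9, §2.3,
  Cor. 2.13 (c).
* [Rogawski1990] J. D. Rogawski, *Automorphic Representations of Unitary Groups in Three Variables*, Ann. of Math. Stud. 123 (1990), §12.2 (3) pp. 173–174.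
* [Keys1984] D. Keys, *Principal series representations of special unitary groups over local fields*, Compositio Math. 51 (1984), §7 Thm. p. 126.
* [BushnellHenniart2006] C. J. Bushnell, G. Henniart, *The Local Langlands Conjecture for GL(2)*, Grundlehren 335 (2006), §1.1, §2.
-/

set_option autoImplicit false

noncomputable section

open scoped MonoidAlgebra
open Literature.RepresentationTheory.FiniteGroups Literature.RepresentationTheory.Semisimple

namespace Literature.NumberTheory.Automorphic

namespace IrrClass

universe u

/-! ## §1 A given `N`: both sides are the character `θ` -/

/-- **THE SAME-EXPONENT LABELLED PAIR, for a given `N`.**  `ρ` smooth on `V : Type`, `N ≤ ρ` `G`-stable with `ρ|_N` and `ρ∕N` irreducible, `r(ρ)` two-dimensional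
with a stable line `ℓ` on which, and modulo which, `M` acts by `θ`, and BOTH `r(ρ|_N) ≠ 0`, `r(ρ∕N) ≠ 0`.  Then the constituents of `ρ` are exactly `⟦ρ∕N⟧`, `⟦ρ|_N⟧`
(★ `isConstituentOf_iff_of_isIrreducible`) and `r(ρ|_N) ≅ (trivial ℂ M ℂ) ⊗ θ ≅ r(ρ∕N)` as `M`-modules (★ exactness + ★ the two cases of [Casselman1995, §7.1], both
disjuncts reading «`θ` on both sides»).  No claim that the two classes differ (that is (R1)+(R2) at the `U(3)` datum, an input elsewhere).
[cite: Casselman1995, L. 7.1.1 (a), Cor. 7.1.2, Prop. 6.4.1, Prop. 3.2.3] [cite: BernsteinZelevinsky1977, §2.3, Cor. 2.13 (c)] [cite: Rogawski1990, §12.2 (3) pp. 173–174] -/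
theorem labelledPair_of_line_same {G : Type u} [Group G] [TopologicalSpace G] [IsTopologicalGroup G]
    (t : ParabolicTriple G) [LocallyCompactSpace t.P] (hNlim : IsLimitOfCompactOpen t.N)
    {V : Type} [AddCommGroup V] [Module ℂ V] {ρ : Representation ℂ G V}
    (hρ : ρ.IsSmooth) (N : Subrepresentation ρ) (hN : N.toRepresentation.IsIrreducible) (hQ : N.quotientRep.IsIrreducible)
    {θ : ↥t.M →* ℂˣ}
    [FiniteDimensional ℂ (t.restrict ρ).Coinvariants] (h2 : Module.finrank ℂ (t.restrict ρ).Coinvariants = 2)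
    (ℓ : Submodule ℂ (t.restrict ρ).Coinvariants) (hℓ1 : Module.finrank ℂ ↥ℓ = 1)
    (hℓ : ∀ (m : ↥t.M), ∀ x ∈ ℓ, ρ.normalizedJacquet t m x = ((θ m : ℂˣ) : ℂ) • x)
    (hq : ∀ (m : ↥t.M) (x : (t.restrict ρ).Coinvariants), ρ.normalizedJacquet t m x - ((θ m : ℂˣ) : ℂ) • x ∈ ℓ)
    [Nontrivial (t.restrict N.toRepresentation).Coinvariants] [Nontrivial (t.restrict N.quotientRep).Coinvariants] :
    (∀ c : IrrClass G, c.IsConstituentOf ρ ↔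
        (c = IrrClass.mk (SmoothIrrep.mk (V ⧸ N.toSubmodule) N.quotientRep hQ (hρ.quotientRep N)) ∨
          c = IrrClass.mk (SmoothIrrep.mk ↥N.toSubmodule N.toRepresentation hN (hρ.toRepresentation N)))) ∧
      Nonempty ((N.toRepresentation.normalizedJacquet t).Equiv ((Representation.trivial ℂ ↥t.M ℂ).twist θ)) ∧
      Nonempty ((N.quotientRep.normalizedJacquet t).Equiv ((Representation.trivial ℂ ↥t.M ℂ).twist θ)) := by
  -- exactness of `r` along `0 → N → ρ → ρ⁄N → 0`
  obtain ⟨hJinj, hJex, hJsurj⟩ := Representation.jacquet_exact_holds (k := ℂ) t hNlim (hρ.toRepresentation N) hρ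
    (hρ.quotientRep N) (Subrepresentation.subtypeIntertwiningMap N) N.mkQ (Subrepresentation.subtypeIntertwiningMap_injective N)
    (exact_subtype_mkQ N) N.mkQ_surjective
  -- the two cases of [Casselman1995, §7.1] (no distinctness of exponents needed); with `θ₁ = θ₂ = θ` both read «`θ` on both sides»
  obtain ⟨hfdN, hfdQ, h1N, h1Q, hcases⟩ := Representation.normalizedJacquet_sub_quot_cases_of_line t
    (Subrepresentation.subtypeIntertwiningMap N) N.mkQ hJinj hJex hJsurj h2 ℓ hℓ1 hℓ hq
  haveI := hfdN
  haveI := hfdQ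
  have hact : (∀ (m : ↥t.M) (x : (t.restrict N.toRepresentation).Coinvariants),
        N.toRepresentation.normalizedJacquet t m x = ((θ m : ℂˣ) : ℂ) • x) ∧
      ∀ (m : ↥t.M) (z : (t.restrict N.quotientRep).Coinvariants), N.quotientRep.normalizedJacquet t m z = ((θ m : ℂˣ) : ℂ) • z := by
    rcases hcases with h | h
    · exact h
    · exact h
  exact ⟨fun c => isConstituentOf_iff_of_isIrreducible hρ N hN hQ c,
    Representation.nonempty_normalizedJacquet_equiv_twist_of_finrank_eq_one t h1N hact.1,
    Representation.nonempty_normalizedJacquet_equiv_twist_of_finrank_eq_one t h1Q hact.2⟩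

/-! ## §2 Abstract `ρ ≅ i_P^G σ`, one call (unifiable binders, as ★ `JacquetLengthTwoLabelsAbs`): from «two distinct constituents» and the embedding property -/

/-- **THE SAME-EXPONENT LABELLED PAIR OF `ρ ≅ i_P^G σ`, ONE CALL, ABSTRACT `ρ`** (the twin of ★ `labelledPair_exists_of_line_abs`: the SAME binder list and the SAME conclusion,
with `(hne : θ₁ ≠ θ₂)` replaced by `(heq : θ₁ = θ₂)` + «two distinct constituents» `htwo`, and `(N) (hNb) (hNt)` dropped — `N` is derived; the line
character `θ₁` and the quotient character `θ₂` are kept as TWO letters with an equation so that a caller may pass a cited filtration verbatim; all class binders implicit, fixed by unification from the line data,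
`eρ := Equiv.refl _` at a caller whose `ρ` is a `def` unfolding to `i_P^G σ`).  For `ρ ≅ i_P^G σ` smooth, `N_P` the union of its compact open subgroups,
`δ_P|_{N_P} = 1`, no 3-chains of subrepresentations, `r(ρ)` two-dimensional and a self-extension of the character `θ` (line `ℓ`: `M` acts by `θ` on `ℓ` and modulo
`ℓ`), two DISTINCT constituents (`htwo`), and the embedding property «every constituent embeds into `ρ ≅ i_P^G σ` or `ρ' ≅ i_P^G σ'`» (`hemb`, [Casselman1995,
Cor. 6.3.9 (b)]): there are classes `πs ≠ πn` such that the constituents of `ρ` are exactly `πn, πs`, and BOTH have normalised Jacquet module `≅ (trivial ℂ M ℂ) ⊗ θ`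
(for representatives).  Proof: `htwo` makes `ρ` reducible (were it irreducible — it is non-zero, ★ `not_isConstituentOf_of_subsingleton` — both constituents would be
`⟦ρ⟧`, ★ `IsConstituentOf.nonempty_equiv_of_isIrreducible`); a `G`-stable `⊥ ≠ N ≠ ⊤` has irreducible `ρ|_N`, `ρ∕N` (no 3-chains); `r(ρ|_N) ≠ 0` by Frobenius on
`N ↪ ρ ≅ i(σ)` and `r(ρ∕N) ≠ 0` by Frobenius on the embedding of a representative of `⟦ρ∕N⟧` (★ `nontrivial_coinvariants_of_injective_normalizedInd`, transported along
the class `Equiv` by ★ `jacquetMap_equiv_injective`); §1; and `⟦ρ|_N⟧ ≠ ⟦ρ∕N⟧` because the constituents are exactly these two classes while `htwo` provides two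
distinct ones.  At the `U(3)` datum (`σ = θ̃` semi-regular, `w θ̃ = θ̃`): the two members of the l.d.s. packet `Π(θ) = JH(i_B(θ̃))` both have `r_B ≅ θ̃` — the
inputs `(hne) (hJH) (hs) (hn)` of E1 row 63's realisation package at `θ₁ = θ₂ := θ̃`.
[cite: Casselman1995, L. 7.1.1 (a), Cor. 7.1.2, Cor. 6.3.9 (b), Prop. 6.4.1, Thm 3.2.4] [cite: BernsteinZelevinsky1977, Prop. 1.9, Cor. 2.13 (c)]
[cite: Rogawski1990, §12.2 (3) pp. 173–174] [cite: Keys1984, §7 Thm. p. 126] [cite: BushnellHenniart2006, §1.1, §2] -/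
theorem labelledPair_exists_of_line_abs_same {G : Type} {instG : Group G} {instT : TopologicalSpace G} {instTG : IsTopologicalGroup G}
    {t : ParabolicTriple G} {instLC : LocallyCompactSpace t.P}
    {V : Type} {instV₁ : AddCommGroup V} {instV₂ : Module ℂ V} {ρ : Representation ℂ G V} {θ₁ θ₂ : ↥t.M →* ℂˣ}
    (hfd : FiniteDimensional ℂ (t.restrict ρ).Coinvariants)
    (h2 : Module.finrank ℂ (t.restrict ρ).Coinvariants = 2)
    (ℓ : Submodule ℂ (t.restrict ρ).Coinvariants) (hℓ1 : Module.finrank ℂ ↥ℓ = 1)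
    (hℓ : ∀ (m : ↥t.M), ∀ x ∈ ℓ, ρ.normalizedJacquet t m x = ((θ₁ m : ℂˣ) : ℂ) • x)
    (hq : ∀ (m : ↥t.M) (x : (t.restrict ρ).Coinvariants), ρ.normalizedJacquet t m x - ((θ₂ m : ℂˣ) : ℂ) • x ∈ ℓ)
    (hNlim : IsLimitOfCompactOpen t.N) (hδ : ∀ (n : G) (hn : n ∈ t.N), deltaChar t.P ⟨n, t.N_le hn⟩ = 1)
    {W : Type} {instW₁ : AddCommGroup W} {instW₂ : Module ℂ W} {σ : Representation ℂ ↥t.M W}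
    (eρ : ρ.Equiv (Representation.normalizedInd t σ))
    (hρ : ρ.IsSmooth)
    (hlen : ∀ N₁ N₂ : Subrepresentation ρ, ¬ (⊥ < N₁ ∧ N₁ < N₂ ∧ N₂ < ⊤)) (heq : θ₁ = θ₂)
    (htwo : ∃ c₁ c₂ : IrrClass G, c₁ ≠ c₂ ∧ c₁.IsConstituentOf ρ ∧ c₂.IsConstituentOf ρ)
    {V' : Type} {instV'₁ : AddCommGroup V'} {instV'₂ : Module ℂ V'} {ρ' : Representation ℂ G V'}
    (hemb : ∀ c : IrrClass G, c.IsConstituentOf ρ → ∃ r : SmoothIrrep G, IrrClass.mk r = c ∧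
      ((∃ f : r.ρ.IntertwiningMap ρ, Function.Injective f) ∨ (∃ f : r.ρ.IntertwiningMap ρ', Function.Injective f)))
    {W' : Type} {instW'₁ : AddCommGroup W'} {instW'₂ : Module ℂ W'} {σ' : Representation ℂ ↥t.M W'}
    (eρ' : ρ'.Equiv (Representation.normalizedInd t σ')) :
    ∃ πs πn : IrrClass G, πs ≠ πn ∧
      (∀ c : IrrClass G, c.IsConstituentOf ρ ↔ (c = πn ∨ c = πs)) ∧
      (∃ r : SmoothIrrep G, IrrClass.mk r = πs ∧
        Nonempty ((r.ρ.normalizedJacquet t).Equiv ((Representation.trivial ℂ ↥t.M ℂ).twist θ₂))) ∧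
      (∃ r : SmoothIrrep G, IrrClass.mk r = πn ∧
        Nonempty ((r.ρ.normalizedJacquet t).Equiv ((Representation.trivial ℂ ↥t.M ℂ).twist θ₁))) := by
  subst heq
  obtain ⟨c₁, c₂, hc₁₂, hc₁, hc₂⟩ := htwo
  -- two distinct constituents force a `G`-stable `⊥ ≠ N ≠ ⊤`
  have hred : ∃ N : Subrepresentation ρ, N ≠ ⊥ ∧ N ≠ ⊤ := by
    by_contra h
    push Not at h
    haveI : Nontrivial V := by
      by_contra hV
      haveI := not_nontrivial_iff_subsingleton.1 hV
      exact not_isConstituentOf_of_subsingleton ρ c₁ hc₁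
    haveI : Nontrivial (Subrepresentation ρ) := ⟨⟨⊥, ⊤, fun hbt => by
      have h' : ((⊥ : Subrepresentation ρ).toSubmodule : Submodule ℂ V) = (⊤ : Subrepresentation ρ).toSubmodule := by rw [hbt]
      exact bot_ne_top h'⟩⟩
    haveI : ρ.IsIrreducible := ⟨fun N => (eq_or_ne N ⊥).elim Or.inl fun hN => Or.inr (h N hN)⟩
    obtain ⟨r₁, rfl⟩ := IrrClass.mk_surjective c₁
    obtain ⟨r₂, rfl⟩ := IrrClass.mk_surjective c₂
    obtain ⟨e₁⟩ := hc₁.nonempty_equiv_of_isIrreducible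
    obtain ⟨e₂⟩ := hc₂.nonempty_equiv_of_isIrreducible
    exact hc₁₂ (IrrClass.mk_eq_mk_of_equiv (e₁.trans e₂.symm))
  obtain ⟨N, hNb, hNt⟩ := hred
  have hN : N.toRepresentation.IsIrreducible := isIrreducible_toRepresentation_of_forall_not_lt_lt hlen hNb hNt
  have hQ : N.quotientRep.IsIrreducible := isIrreducible_quotientRep_of_forall_not_lt_lt hlen hNb hNt
  let rs : SmoothIrrep G := SmoothIrrep.mk ↥N.toSubmodule N.toRepresentation hN (hρ.toRepresentation N)
  let rn : SmoothIrrep G := SmoothIrrep.mk (_ ⧸ N.toSubmodule) N.quotientRep hQ (hρ.quotientRep N)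
  have hcons : ∀ c : IrrClass G, c.IsConstituentOf ρ ↔ (c = IrrClass.mk rn ∨ c = IrrClass.mk rs) :=
    fun c => isConstituentOf_iff_of_isIrreducible hρ N hN hQ c
  -- `r(ρ|_N) ≠ 0`: Frobenius on `ρ|_N ↪ ρ ≅ i(σ)`
  haveI : Nontrivial ↥N.toSubmodule := Representation.IsIrreducible.nontrivial N.toRepresentation
  haveI hJN : Nontrivial (t.restrict N.toRepresentation).Coinvariants :=
    nontrivial_coinvariants_of_injective_normalizedInd t hδ σ N.toRepresentation (hρ.toRepresentation N)
      (eρ.toIntertwiningMap.comp (Subrepresentation.subtypeIntertwiningMap N))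
      (eρ.toLinearEquiv.injective.comp (Subrepresentation.subtypeIntertwiningMap_injective N))
  -- `r(ρ⁄N) ≠ 0`: `⟦ρ⁄N⟧` is a constituent, so a representative embeds into `ρ ≅ i(σ)` or `ρ' ≅ i(σ')` (Cor. 6.3.9 (b)); Frobenius there
  haveI hJQ : Nontrivial (t.restrict N.quotientRep).Coinvariants := by
    obtain ⟨r, hr, hfr⟩ := hemb (IrrClass.mk rn) ((hcons _).2 (Or.inl rfl))
    obtain ⟨e⟩ := (IrrClass.mk_eq_mk_iff r rn).1 hr
    haveI : Nontrivial r.V := Representation.IsIrreducible.nontrivial r.ρ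
    haveI : Nontrivial (t.restrict r.ρ).Coinvariants := by
      rcases hfr with ⟨f, hf⟩ | ⟨f, hf⟩
      · exact nontrivial_coinvariants_of_injective_normalizedInd t hδ σ r.ρ r.isSmooth (eρ.toIntertwiningMap.comp f)
          (eρ.toLinearEquiv.injective.comp hf)
      · exact nontrivial_coinvariants_of_injective_normalizedInd t hδ σ' r.ρ r.isSmooth (eρ'.toIntertwiningMap.comp f)
          (eρ'.toLinearEquiv.injective.comp hf)
    exact (jacquetMap_equiv_injective t e).nontrivial
  -- §1: both sides carry `θ`
  haveI := hfd
  obtain ⟨-, hes, hen⟩ := labelledPair_of_line_same t hNlim hρ N hN hQ h2 ℓ hℓ1 hℓ hq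
  -- the two classes differ: they exhaust the constituents, and `c₁ ≠ c₂` are both constituents
  have hsep : IrrClass.mk rs ≠ IrrClass.mk rn := by
    intro hsn
    rcases (hcons c₁).1 hc₁ with h₁ | h₁ <;> rcases (hcons c₂).1 hc₂ with h₂ | h₂
    · exact hc₁₂ (h₁.trans h₂.symm)
    · exact hc₁₂ (h₁.trans (hsn.symm.trans h₂.symm))
    · exact hc₁₂ (h₁.trans (hsn.trans h₂.symm))
    · exact hc₁₂ (h₁.trans h₂.symm)
  exact ⟨IrrClass.mk rs, IrrClass.mk rn, hsep, hcons, ⟨rs, rfl, hes⟩, ⟨rn, rfl, hen⟩⟩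

/-! ## §3 `ρ = i_P^G σ` literally (the currency of ★ `JacquetLengthTwoLabelsEmb`) -/

/-- **THE SAME-EXPONENT LABELLED PAIR OF `i_P^G σ`, ONE CALL** (§2 at `eρ := Equiv.refl`, `eρ' := Equiv.refl`; the twin of ★
`labelledPair_exists_of_line_normalizedInd`: same binders and conclusion, `(N) (hNb) (hNt) (hne)` replaced by `(heq : θ₁ = θ₂)` + «two distinct constituents» `htwo`).  Output = the inputs
`(hne) (hJH) (hs) (hn)` of E1 row 63's realisation package at `θ₁ = θ₂ = θ`, token for token.
[cite: Casselman1995, L. 7.1.1 (a), Cor. 7.1.2, Cor. 6.3.9 (b), Prop. 6.4.1, Thm 3.2.4] [cite: BernsteinZelevinsky1977, Prop. 1.9, Cor. 2.13 (c)]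
[cite: Rogawski1990, §12.2 (3) pp. 173–174] [cite: Keys1984, §7 Thm. p. 126] -/
theorem labelledPair_exists_of_line_normalizedInd_same {G : Type} [Group G] [TopologicalSpace G] [IsTopologicalGroup G]
    (t : ParabolicTriple G) [LocallyCompactSpace t.P] {W : Type} [AddCommGroup W] [Module ℂ W] {σ : Representation ℂ ↥t.M W}
    {W' : Type} [AddCommGroup W'] [Module ℂ W'] {σ' : Representation ℂ ↥t.M W'} {θ₁ θ₂ : ↥t.M →* ℂˣ}
    (hfd : FiniteDimensional ℂ (t.restrict (Representation.normalizedInd t σ)).Coinvariants)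
    (h2 : Module.finrank ℂ (t.restrict (Representation.normalizedInd t σ)).Coinvariants = 2)
    (ℓ : Submodule ℂ (t.restrict (Representation.normalizedInd t σ)).Coinvariants) (hℓ1 : Module.finrank ℂ ↥ℓ = 1)
    (hℓ : ∀ (m : ↥t.M), ∀ x ∈ ℓ, (Representation.normalizedInd t σ).normalizedJacquet t m x = ((θ₁ m : ℂˣ) : ℂ) • x)
    (hq : ∀ (m : ↥t.M) (x : (t.restrict (Representation.normalizedInd t σ)).Coinvariants),
      (Representation.normalizedInd t σ).normalizedJacquet t m x - ((θ₂ m : ℂˣ) : ℂ) • x ∈ ℓ)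
    (hNlim : IsLimitOfCompactOpen t.N) (hδ : ∀ (n : G) (hn : n ∈ t.N), deltaChar t.P ⟨n, t.N_le hn⟩ = 1)
    (hρ : (Representation.normalizedInd t σ).IsSmooth)
    (hlen : ∀ N₁ N₂ : Subrepresentation (Representation.normalizedInd t σ), ¬ (⊥ < N₁ ∧ N₁ < N₂ ∧ N₂ < ⊤)) (heq : θ₁ = θ₂)
    (htwo : ∃ c₁ c₂ : IrrClass G, c₁ ≠ c₂ ∧ c₁.IsConstituentOf (Representation.normalizedInd t σ) ∧
      c₂.IsConstituentOf (Representation.normalizedInd t σ))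
    (hemb : ∀ c : IrrClass G, c.IsConstituentOf (Representation.normalizedInd t σ) → ∃ r : SmoothIrrep G, IrrClass.mk r = c ∧
      ((∃ f : r.ρ.IntertwiningMap (Representation.normalizedInd t σ), Function.Injective f) ∨
        (∃ f : r.ρ.IntertwiningMap (Representation.normalizedInd t σ'), Function.Injective f))) :
    ∃ πs πn : IrrClass G, πs ≠ πn ∧
      (∀ c : IrrClass G, c.IsConstituentOf (Representation.normalizedInd t σ) ↔ (c = πn ∨ c = πs)) ∧
      (∃ r : SmoothIrrep G, IrrClass.mk r = πs ∧
        Nonempty ((r.ρ.normalizedJacquet t).Equiv ((Representation.trivial ℂ ↥t.M ℂ).twist θ₂))) ∧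
      (∃ r : SmoothIrrep G, IrrClass.mk r = πn ∧
        Nonempty ((r.ρ.normalizedJacquet t).Equiv ((Representation.trivial ℂ ↥t.M ℂ).twist θ₁))) :=
  labelledPair_exists_of_line_abs_same hfd h2 ℓ hℓ1 hℓ hq hNlim hδ (Representation.Equiv.refl _) hρ hlen heq htwo hemb
    (σ' := σ') (Representation.Equiv.refl _)

end IrrClass

end Literature.NumberTheory.Automorphic

end
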